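import Summits.CriticalPhenomena.Ising3DConformalLimit.Theses.FKParityRobustness
import Summits.CriticalPhenomena.Ising3DConformalLimit.Theorems.FKParityRobustnessIndependentStrandsJoinShapeLoopDictionary
import HarnessLib

/-!
# The loop-language ∃-shape dictionary, II: SME ⟹ LSM, the equivalence with clause (iii), and the crux ⟹ LSM

Companion of `…ShapeLoopDictionary.lean` (crux `IndependentStrandsJoin`, item stmt-CriticalPhenomena-14625; line `pinch-to-tetra` r5,
lead c5-0).  With LSM ("loop shape merging": `∃ a injective, ∃ c > 0, ∀ L₀, ∃ L ≥ L₀, ∃ N₀, ∀ N ≥ N₀`, at `b = L•a ⊂ Λ_N`,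
`c·Z_N(b₀b₁)Z_N(b₂b₃) ≤ Σ_π jointSum_N,π(b)`, spelled out verbatim) and SME (far merging of the critical Ursell function along all large
dilations of some injective lattice shape):
* `loopShapeMergingEventually_of_shapeMergingEventually` — **SME ⟹ LSM at ALL large dilations** (strict critical-state margin → boxes,
  `boxDefect_lt_of_criticalDefect`; general upper sandwich `−U₄·(Z⁰)² ≤ Σ_π jointSum_π`, `ShapeSandwich.neg_connectedFour_mul_sq_le_jointSum3`).
* `nonGaussianLimit_iff_loopShapeMerging` — **under `LimitExists`: `NonGaussianLimit` (item stmt-CriticalPhenomena-0636) ↔ LSM**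
  (→ landed `nonGaussianLimit_iff_shapeMergingEventually` + the above; ← `nonGaussianLimit_of_loopShapeMerging`, no limit needed).
  Registered sub-goal `stub_shapeLoopDictionary`.
* `loopShapeMerging_of_independentStrandsJoin` — the present crux implies LSM outright (tetrahedron, first pairing).
So restating the crux as LSM keeps the route's thesis (two INDEPENDENT critical HT strands join, now: along SOME lattice shape, for at
least one pairing, infinitely often in the dilation) and yields a leaf kernel-EQUIVALENT to item 0636 modulo `LimitExists`.

References: M. Aizenman, Comm. Math. Phys. 86 (1982), Prop. 5.3 [AizenmanCMP1982]; M. Aizenman, H. Duminil-Copin, V. Sidoravicius,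
Comm. Math. Phys. 334 (2015), Thm. 1.2 [AizenmanDuminilCopinSidoraviciusCMP2015].
-/

noncomputable section

open Filter Topology Finset SimpleGraph
open Literature.Probability.LatticeModels
open Summit.CriticalPhenomena.Ising3DConformalLimit.Theses.FKParityRobustness
open Summit.CriticalPhenomena.Ising3DConformalLimit.FKParityRobustnessLatticeBoundFromStrands (twoPoint_eq_loopO1_div)
open Summit.CriticalPhenomena.Ising3DConformalLimit.Cruxes.IsingEuclidUpgradeR4NonGaussian.FreeCovarianceDeltaDichotomy
  (criticalCorr_two_pos')
open Summit.CriticalPhenomena.Ising3DConformalLimit.Cruxes.ParityRobustMerging.PlaquetteXorSurgery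
  (tetra tetra_inj tanh_criticalBeta_nonneg)

namespace Summit.CriticalPhenomena.Ising3DConformalLimit.Cruxes.IndependentStrandsJoin.PinchToTetra

open scoped Classical BigOperators

/-! ## SME ⟹ LSM (even at all large dilations) -/

/-- **SME ⟹ LSM at ALL large dilations**: far merging of the critical Ursell function along the large dilations of an injective
lattice shape `a` (constant `c`) gives, in every large free box, the pairing-summed independent-strands bound with constant `c/2`:
the strict critical-state margin passes to boxes (`boxDefect_lt_of_criticalDefect`) and the general upper sandwich
`−U₄·(Z⁰)² ≤ Σ_π jointSum_π` (`ShapeSandwich.neg_connectedFour_mul_sq_le_jointSum3`) converts it, clearing `(Z⁰)² > 0`. [folklore] -/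
theorem loopShapeMergingEventually_of_shapeMergingEventually
    (h : ∃ c : ℝ, 0 < c ∧ ∃ a : Fin 4 → Site 3, Function.Injective a ∧ ∃ L₁ : ℕ, ∀ L : ℕ, L₁ ≤ L →
      criticalCorr 3 4 (fun i => (L : ℤ) • a i) -
          (criticalCorr 3 2 ![(L : ℤ) • a 0, (L : ℤ) • a 1] * criticalCorr 3 2 ![(L : ℤ) • a 2, (L : ℤ) • a 3] +
            criticalCorr 3 2 ![(L : ℤ) • a 0, (L : ℤ) • a 2] * criticalCorr 3 2 ![(L : ℤ) • a 1, (L : ℤ) • a 3] +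
            criticalCorr 3 2 ![(L : ℤ) • a 0, (L : ℤ) • a 3] * criticalCorr 3 2 ![(L : ℤ) • a 1, (L : ℤ) • a 2]) ≤
        -(c * (criticalCorr 3 2 ![(L : ℤ) • a 0, (L : ℤ) • a 1] * criticalCorr 3 2 ![(L : ℤ) • a 2, (L : ℤ) • a 3]))) :
    ∃ a : Fin 4 → Site 3, Function.Injective a ∧ ∃ c : ℝ, 0 < c ∧ ∃ L₁ : ℕ, ∀ L : ℕ, L₁ ≤ L →
      ∃ N₀ : ℕ, ∀ N : ℕ, N₀ ≤ N → ∀ b : Fin 4 → ↥(box 3 N), (∀ i, ((b i : Site 3)) = (L : ℤ) • a i) →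
        c * loopO1PartitionFunction ((zdGraph 3).comap (Subtype.val : ↥(box 3 N) → Site 3)) (Real.tanh (criticalBeta 3)) {b 0, b 1} *
            loopO1PartitionFunction ((zdGraph 3).comap (Subtype.val : ↥(box 3 N) → Site 3)) (Real.tanh (criticalBeta 3)) {b 2, b 3} ≤
          (∑ F₁ ∈ tJoins ((zdGraph 3).comap (Subtype.val : ↥(box 3 N) → Site 3)) Set.univ {b 0, b 1},
              ∑ F₂ ∈ tJoins ((zdGraph 3).comap (Subtype.val : ↥(box 3 N) → Site 3)) Set.univ {b 2, b 3},
                if (SimpleGraph.fromEdgeSet ((↑F₁ : Set (Sym2 ↥(box 3 N))) ∪ ↑F₂)).Reachable (b 0) (b 2)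
                then Real.tanh (criticalBeta 3) ^ (F₁.card + F₂.card) else 0) +
          (∑ F₁ ∈ tJoins ((zdGraph 3).comap (Subtype.val : ↥(box 3 N) → Site 3)) Set.univ {b 0, b 2},
              ∑ F₂ ∈ tJoins ((zdGraph 3).comap (Subtype.val : ↥(box 3 N) → Site 3)) Set.univ {b 1, b 3},
                if (SimpleGraph.fromEdgeSet ((↑F₁ : Set (Sym2 ↥(box 3 N))) ∪ ↑F₂)).Reachable (b 0) (b 1)
                then Real.tanh (criticalBeta 3) ^ (F₁.card + F₂.card) else 0) +
          (∑ F₁ ∈ tJoins ((zdGraph 3).comap (Subtype.val : ↥(box 3 N) → Site 3)) Set.univ {b 0, b 3},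
              ∑ F₂ ∈ tJoins ((zdGraph 3).comap (Subtype.val : ↥(box 3 N) → Site 3)) Set.univ {b 1, b 2},
                if (SimpleGraph.fromEdgeSet ((↑F₁ : Set (Sym2 ↥(box 3 N))) ∪ ↑F₂)).Reachable (b 0) (b 1)
                then Real.tanh (criticalBeta 3) ^ (F₁.card + F₂.card) else 0) := by
  obtain ⟨c, hc, a, ha, L₁, hev⟩ := h
  obtain ⟨M, hM⟩ := exists_radius_smul_mem_box a
  have hβ : 0 ≤ criticalBeta 3 := criticalBeta_nonneg 3
  refine ⟨a, ha, c / 2, by positivity, max L₁ 1, fun L hL => ?_⟩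
  have hL₁ : L₁ ≤ L := le_of_max_le_left hL
  have hL1 : 1 ≤ L := le_of_max_le_right hL
  have hl0 : ((L : ℕ) : ℤ) ≠ 0 := by exact_mod_cast (Nat.one_le_iff_ne_zero.1 hL1)
  have hy : Function.Injective (fun i : Fin 4 => (L : ℤ) • a i) := fun i j hij =>
    ha (smul_right_injective (Site 3) hl0 hij)
  have hcrit := hev L hL₁
  have hGG : 0 < criticalCorr 3 2 ![(L : ℤ) • a 0, (L : ℤ) • a 1] * criticalCorr 3 2 ![(L : ℤ) • a 2, (L : ℤ) • a 3] :=
    mul_pos (criticalCorr_two_pos' _ _) (criticalCorr_two_pos' _ _)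
  have hlt : criticalCorr 3 4 (fun i => (L : ℤ) • a i) -
        (criticalCorr 3 2 ![(L : ℤ) • a 0, (L : ℤ) • a 1] * criticalCorr 3 2 ![(L : ℤ) • a 2, (L : ℤ) • a 3] +
          criticalCorr 3 2 ![(L : ℤ) • a 0, (L : ℤ) • a 2] * criticalCorr 3 2 ![(L : ℤ) • a 1, (L : ℤ) • a 3] +
          criticalCorr 3 2 ![(L : ℤ) • a 0, (L : ℤ) • a 3] * criticalCorr 3 2 ![(L : ℤ) • a 1, (L : ℤ) • a 2]) +
      c / 2 * (criticalCorr 3 2 ![(L : ℤ) • a 0, (L : ℤ) • a 1] * criticalCorr 3 2 ![(L : ℤ) • a 2, (L : ℤ) • a 3]) < 0 := by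
    nlinarith
  obtain ⟨N₀, -, hbox'⟩ := boxDefect_lt_of_criticalDefect (y := fun i => (L : ℤ) • a i) (c := c / 2) (L * M) hlt
  refine ⟨N₀, fun N hN b hb => ?_⟩
  have hbinj : Function.Injective b := fun i j hij =>
    hy (by have e := congrArg Subtype.val hij; rwa [hb i, hb j] at e)
  have hneg := hbox' N hN b hb
  have hsand := ShapeSandwich.neg_connectedFour_mul_sq_le_jointSum3 ((zdGraph 3).comap (Subtype.val : ↥(box 3 N) → Site 3)) hβ b hbinj
  have hZ0 : 0 < loopO1PartitionFunction ((zdGraph 3).comap (Subtype.val : ↥(box 3 N) → Site 3)) (Real.tanh (criticalBeta 3)) ∅ :=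
    loopO1PartitionFunction_empty_pos _ tanh_criticalBeta_nonneg
  rw [twoPoint_eq_loopO1_div hβ (hbinj.ne (by decide)), twoPoint_eq_loopO1_div hβ (hbinj.ne (by decide))] at hneg
  set U := connectedFour (isingMeasure ((zdGraph 3).comap (Subtype.val : ↥(box 3 N) → Site 3)) Finset.univ (criticalBeta 3) 0 .free) spinAt b with hU
  set Z0 := loopO1PartitionFunction ((zdGraph 3).comap (Subtype.val : ↥(box 3 N) → Site 3)) (Real.tanh (criticalBeta 3)) ∅ with hZ0_def
  set Z01 := loopO1PartitionFunction ((zdGraph 3).comap (Subtype.val : ↥(box 3 N) → Site 3)) (Real.tanh (criticalBeta 3)) {b 0, b 1} with hZ01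
  set Z23 := loopO1PartitionFunction ((zdGraph 3).comap (Subtype.val : ↥(box 3 N) → Site 3)) (Real.tanh (criticalBeta 3)) {b 2, b 3} with hZ23
  have hZ0' : Z0 ≠ 0 := hZ0.ne'
  have key : c / 2 * Z01 * Z23 < -U * Z0 ^ 2 := by
    have h1 := mul_lt_mul_of_pos_right hneg (pow_pos hZ0 2)
    rw [zero_mul] at h1
    have e : (U + c / 2 * (Z01 / Z0 * (Z23 / Z0))) * Z0 ^ 2 = U * Z0 ^ 2 + c / 2 * Z01 * Z23 := by
      field_simp
    rw [e] at h1
    linarith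
  linarith

/-! ## The dictionary -/

/-- **Under `LimitExists`: `NonGaussianLimit` (item stmt-CriticalPhenomena-0636) ↔ LSM** — clause (iii) for the limit is EQUIVALENT to the
pairing-summed independent-strands join along infinitely many dilations of SOME injective lattice shape (→ the landed
`nonGaussianLimit_iff_shapeMergingEventually` and `loopShapeMergingEventually_of_shapeMergingEventually`; ← `nonGaussianLimit_of_loopShapeMerging`,
which needs no limit). [folklore] -/
theorem nonGaussianLimit_iff_loopShapeMerging (hL : LimitExists) :
    NonGaussianLimit ↔
      ∃ a : Fin 4 → Site 3, Function.Injective a ∧ ∃ c : ℝ, 0 < c ∧ ∀ L₀ : ℕ, ∃ L : ℕ, L₀ ≤ L ∧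
      ∃ N₀ : ℕ, ∀ N : ℕ, N₀ ≤ N → ∀ b : Fin 4 → ↥(box 3 N), (∀ i, ((b i : Site 3)) = (L : ℤ) • a i) →
        c * loopO1PartitionFunction ((zdGraph 3).comap (Subtype.val : ↥(box 3 N) → Site 3)) (Real.tanh (criticalBeta 3)) {b 0, b 1} *
            loopO1PartitionFunction ((zdGraph 3).comap (Subtype.val : ↥(box 3 N) → Site 3)) (Real.tanh (criticalBeta 3)) {b 2, b 3} ≤
          (∑ F₁ ∈ tJoins ((zdGraph 3).comap (Subtype.val : ↥(box 3 N) → Site 3)) Set.univ {b 0, b 1},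
              ∑ F₂ ∈ tJoins ((zdGraph 3).comap (Subtype.val : ↥(box 3 N) → Site 3)) Set.univ {b 2, b 3},
                if (SimpleGraph.fromEdgeSet ((↑F₁ : Set (Sym2 ↥(box 3 N))) ∪ ↑F₂)).Reachable (b 0) (b 2)
                then Real.tanh (criticalBeta 3) ^ (F₁.card + F₂.card) else 0) +
          (∑ F₁ ∈ tJoins ((zdGraph 3).comap (Subtype.val : ↥(box 3 N) → Site 3)) Set.univ {b 0, b 2},
              ∑ F₂ ∈ tJoins ((zdGraph 3).comap (Subtype.val : ↥(box 3 N) → Site 3)) Set.univ {b 1, b 3},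
                if (SimpleGraph.fromEdgeSet ((↑F₁ : Set (Sym2 ↥(box 3 N))) ∪ ↑F₂)).Reachable (b 0) (b 1)
                then Real.tanh (criticalBeta 3) ^ (F₁.card + F₂.card) else 0) +
          (∑ F₁ ∈ tJoins ((zdGraph 3).comap (Subtype.val : ↥(box 3 N) → Site 3)) Set.univ {b 0, b 3},
              ∑ F₂ ∈ tJoins ((zdGraph 3).comap (Subtype.val : ↥(box 3 N) → Site 3)) Set.univ {b 1, b 2},
                if (SimpleGraph.fromEdgeSet ((↑F₁ : Set (Sym2 ↥(box 3 N))) ∪ ↑F₂)).Reachable (b 0) (b 1)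
                then Real.tanh (criticalBeta 3) ^ (F₁.card + F₂.card) else 0) := by
  constructor
  · intro h
    obtain ⟨a, ha, c, hc, L₁, hev⟩ :=
      loopShapeMergingEventually_of_shapeMergingEventually ((nonGaussianLimit_iff_shapeMergingEventually hL).1 h)
    exact ⟨a, ha, c, hc, fun L₀ => ⟨max L₀ L₁, le_max_left _ _, hev _ (le_max_right _ _)⟩⟩
  · exact nonGaussianLimit_of_loopShapeMerging

/-- **The crux implies LSM outright** (at the tetrahedron `a = tetra`, every scale `L ≥ 1`, the first pairing alone; the other two joint
sums are nonnegative): a restated crux `LSM` is implied by the present one. [folklore] -/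
theorem loopShapeMerging_of_independentStrandsJoin (h : IndependentStrandsJoin) :
    ∃ a : Fin 4 → Site 3, Function.Injective a ∧ ∃ c : ℝ, 0 < c ∧ ∀ L₀ : ℕ, ∃ L : ℕ, L₀ ≤ L ∧
      ∃ N₀ : ℕ, ∀ N : ℕ, N₀ ≤ N → ∀ b : Fin 4 → ↥(box 3 N), (∀ i, ((b i : Site 3)) = (L : ℤ) • a i) →
        c * loopO1PartitionFunction ((zdGraph 3).comap (Subtype.val : ↥(box 3 N) → Site 3)) (Real.tanh (criticalBeta 3)) {b 0, b 1} *
            loopO1PartitionFunction ((zdGraph 3).comap (Subtype.val : ↥(box 3 N) → Site 3)) (Real.tanh (criticalBeta 3)) {b 2, b 3} ≤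
          (∑ F₁ ∈ tJoins ((zdGraph 3).comap (Subtype.val : ↥(box 3 N) → Site 3)) Set.univ {b 0, b 1},
              ∑ F₂ ∈ tJoins ((zdGraph 3).comap (Subtype.val : ↥(box 3 N) → Site 3)) Set.univ {b 2, b 3},
                if (SimpleGraph.fromEdgeSet ((↑F₁ : Set (Sym2 ↥(box 3 N))) ∪ ↑F₂)).Reachable (b 0) (b 2)
                then Real.tanh (criticalBeta 3) ^ (F₁.card + F₂.card) else 0) +
          (∑ F₁ ∈ tJoins ((zdGraph 3).comap (Subtype.val : ↥(box 3 N) → Site 3)) Set.univ {b 0, b 2},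
              ∑ F₂ ∈ tJoins ((zdGraph 3).comap (Subtype.val : ↥(box 3 N) → Site 3)) Set.univ {b 1, b 3},
                if (SimpleGraph.fromEdgeSet ((↑F₁ : Set (Sym2 ↥(box 3 N))) ∪ ↑F₂)).Reachable (b 0) (b 1)
                then Real.tanh (criticalBeta 3) ^ (F₁.card + F₂.card) else 0) +
          (∑ F₁ ∈ tJoins ((zdGraph 3).comap (Subtype.val : ↥(box 3 N) → Site 3)) Set.univ {b 0, b 3},
              ∑ F₂ ∈ tJoins ((zdGraph 3).comap (Subtype.val : ↥(box 3 N) → Site 3)) Set.univ {b 1, b 2},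
                if (SimpleGraph.fromEdgeSet ((↑F₁ : Set (Sym2 ↥(box 3 N))) ∪ ↑F₂)).Reachable (b 0) (b 1)
                then Real.tanh (criticalBeta 3) ^ (F₁.card + F₂.card) else 0) := by
  obtain ⟨c, hc, hall⟩ := h
  have ht : 0 ≤ Real.tanh (criticalBeta 3) := tanh_criticalBeta_nonneg
  refine ⟨tetra, tetra_inj, c, hc, fun L₀ => ⟨max L₀ 1, le_max_left _ _, ?_⟩⟩
  obtain ⟨N₀, hN⟩ := hall (max L₀ 1) (le_max_right _ _)
  refine ⟨N₀, fun N hNN b hb => ?_⟩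
  have h1 := hN N hNN b (fun i => by simpa [tetra] using hb i)
  have h2 : 0 ≤ ∑ F₁ ∈ tJoins ((zdGraph 3).comap (Subtype.val : ↥(box 3 N) → Site 3)) Set.univ {b 0, b 2},
      ∑ F₂ ∈ tJoins ((zdGraph 3).comap (Subtype.val : ↥(box 3 N) → Site 3)) Set.univ {b 1, b 3},
        (if (SimpleGraph.fromEdgeSet ((↑F₁ : Set (Sym2 ↥(box 3 N))) ∪ ↑F₂)).Reachable (b 0) (b 1)
        then Real.tanh (criticalBeta 3) ^ (F₁.card + F₂.card) else 0) :=
    Finset.sum_nonneg fun _ _ => Finset.sum_nonneg fun _ _ => by split_ifs <;> first | exact pow_nonneg ht _ | exact le_rfl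
  have h3 : 0 ≤ ∑ F₁ ∈ tJoins ((zdGraph 3).comap (Subtype.val : ↥(box 3 N) → Site 3)) Set.univ {b 0, b 3},
      ∑ F₂ ∈ tJoins ((zdGraph 3).comap (Subtype.val : ↥(box 3 N) → Site 3)) Set.univ {b 1, b 2},
        (if (SimpleGraph.fromEdgeSet ((↑F₁ : Set (Sym2 ↥(box 3 N))) ∪ ↑F₂)).Reachable (b 0) (b 1)
        then Real.tanh (criticalBeta 3) ^ (F₁.card + F₂.card) else 0) :=
    Finset.sum_nonneg fun _ _ => Finset.sum_nonneg fun _ _ => by split_ifs <;> first | exact pow_nonneg ht _ | exact le_rfl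
  simp only at h1
  linarith

end Summit.CriticalPhenomena.Ising3DConformalLimit.Cruxes.IndependentStrandsJoin.PinchToTetra

/-! ## The registered sub-goal `stub_shapeLoopDictionary` -/

namespace Summit.CriticalPhenomena.Ising3DConformalLimit.Theorems

open Summit.CriticalPhenomena.Ising3DConformalLimit.Cruxes.IndependentStrandsJoin.PinchToTetra

open scoped Classical in
/-- **Registered sub-goal `stub_shapeLoopDictionary` of the crux `IndependentStrandsJoin`** (stmt-CriticalPhenomena-14625, line `pinch-to-tetra` r5):
under `LimitExists`, `NonGaussianLimit` (item stmt-CriticalPhenomena-0636) is EQUIVALENT to the loop-language ∃-shape statement LSM — two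
independent critical sourced loop-O(1) configurations along infinitely many dilations of SOME injective lattice shape join, for at least one
of the three pairings, with weight `≥ c·Z·Z` (`PinchToTetra.nonGaussianLimit_iff_loopShapeMerging`). -/
theorem stub_shapeLoopDictionary :
    LimitExists → (NonGaussianLimit ↔
      ∃ a : Fin 4 → Site 3, Function.Injective a ∧ ∃ c : ℝ, 0 < c ∧ ∀ L₀ : ℕ, ∃ L : ℕ, L₀ ≤ L ∧
      ∃ N₀ : ℕ, ∀ N : ℕ, N₀ ≤ N → ∀ b : Fin 4 → ↥(box 3 N), (∀ i, ((b i : Site 3)) = (L : ℤ) • a i) →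
        c * loopO1PartitionFunction ((zdGraph 3).comap (Subtype.val : ↥(box 3 N) → Site 3)) (Real.tanh (criticalBeta 3)) {b 0, b 1} *
            loopO1PartitionFunction ((zdGraph 3).comap (Subtype.val : ↥(box 3 N) → Site 3)) (Real.tanh (criticalBeta 3)) {b 2, b 3} ≤
          (∑ F₁ ∈ tJoins ((zdGraph 3).comap (Subtype.val : ↥(box 3 N) → Site 3)) Set.univ {b 0, b 1},
              ∑ F₂ ∈ tJoins ((zdGraph 3).comap (Subtype.val : ↥(box 3 N) → Site 3)) Set.univ {b 2, b 3},
                if (SimpleGraph.fromEdgeSet ((↑F₁ : Set (Sym2 ↥(box 3 N))) ∪ ↑F₂)).Reachable (b 0) (b 2)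
                then Real.tanh (criticalBeta 3) ^ (F₁.card + F₂.card) else 0) +
          (∑ F₁ ∈ tJoins ((zdGraph 3).comap (Subtype.val : ↥(box 3 N) → Site 3)) Set.univ {b 0, b 2},
              ∑ F₂ ∈ tJoins ((zdGraph 3).comap (Subtype.val : ↥(box 3 N) → Site 3)) Set.univ {b 1, b 3},
                if (SimpleGraph.fromEdgeSet ((↑F₁ : Set (Sym2 ↥(box 3 N))) ∪ ↑F₂)).Reachable (b 0) (b 1)
                then Real.tanh (criticalBeta 3) ^ (F₁.card + F₂.card) else 0) +
          (∑ F₁ ∈ tJoins ((zdGraph 3).comap (Subtype.val : ↥(box 3 N) → Site 3)) Set.univ {b 0, b 3},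
              ∑ F₂ ∈ tJoins ((zdGraph 3).comap (Subtype.val : ↥(box 3 N) → Site 3)) Set.univ {b 1, b 2},
                if (SimpleGraph.fromEdgeSet ((↑F₁ : Set (Sym2 ↥(box 3 N))) ∪ ↑F₂)).Reachable (b 0) (b 1)
                then Real.tanh (criticalBeta 3) ^ (F₁.card + F₂.card) else 0)) :=
  nonGaussianLimit_iff_loopShapeMerging

end Summit.CriticalPhenomena.Ising3DConformalLimit.Theorems

end
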